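import Literature.Topology.FourManifolds.FoldChartSigCritical
import Literature.Topology.FourManifolds.GenericFoldChart
import Literature.Topology.FourManifolds.RankOneFoldPoint
import Literature.Topology.FourManifolds.RegularValuePreimage
import Mathlib.Analysis.Calculus.BumpFunction.FiniteDimension
import HarnessLib

/-!
# Pushing a fold arc: the model perturbation keeps exactly the fold axis critical

Topic `Literature/Topology/FourManifolds` (programme of the fact
`Literature.Topology.FourManifolds.exists_isSimplifiedBrokenLefschetzFibration`, Baykur–Saeki 2017, §2.1
and §3: a generic map `X⁴ → Σ²` restricted to its fold locus is an immersion with normal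
crossings, and the always-realisable base-diagram moves start by isotoping pieces of fold
image).  The basic local tool is the **push of a fold arc**: in a fold chart
`F₀ = (t, s₁x₁² + s₂x₂² + s₃x₃²)` replace `F₀` by
`F_θ(y) = F₀(y) + β₁(t) β₂(x) θ`, where `β₁` is a bump in the axis variable, `β₂` a bump in the
fibre variables equal to `1` near the axis, and `θ ∈ ℝ²` small.  This file proves the two model
facts:

* `surjective_fderiv_foldPushMap_iff` — for `‖θ‖` small the critical set of `F_θ` is EXACTLY
  the `t`-axis `{x = 0}` (as for `F₀`): near the axis by an explicit computation, on the rest of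
  the support of the bump because submersivity is an open condition jointly in `(θ, y)`
  (`isOpen_inter_setOf_surjective`) and that part of the support is compact (tube lemma), and
  off the support because `F_θ = F₀` there;
* `foldPushMap_eq_near_axis` — near the axis `F_θ = T_θ ∘ F₀` with the plane map
  `T_θ(a, b) = (a + θ₀ β₁(a), b + θ₁ β₁(a))` (so the fold image `{(t, 0)}` is pushed to the
  graph `{(t + θ₀β₁(t), θ₁β₁(t))}`, a translate by `θ` where `β₁ = 1`).

Everything is proved; the model maps are the only definitions; no named facts (D-0026).

## References

* R. İ. Baykur, O. Saeki, *Simplifying indefinite fibrations on 4-manifolds*, arXiv:1705.11169,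
  §2.1 p. 6, §3. [BaykurSaeki2017]
* M. Golubitsky, V. Guillemin, *Stable Mappings and Their Singularities*, GTM 14 (1973), Ch. III
  §4 (folds), Ch. II §4 (multijet transversality). [GolubitskyGuillemin1973]
-/

noncomputable section

set_option maxSynthPendingDepth 2

open Set Function Filter Module Metric
open scoped ContDiff Topology

namespace Literature.Topology.FourManifolds

/-- Local notation: `𝔼 n` is the model Euclidean space `EuclideanSpace ℝ (Fin n)`. -/
local notation "𝔼 " n:arg => EuclideanSpace ℝ (Fin n)

/-- Local notation: the coordinate covectors of `ℝ⁴`. -/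
local notation "π₄" => (EuclideanSpace.proj (𝕜 := ℝ) (ι := Fin 4))

namespace FoldPush

variable (s₁ s₂ s₃ : ℝ) (β₁ : ContDiffBump (0 : ℝ)) (β₂ : ContDiffBump (0 : 𝔼 3))

/-- The push bump `β(y) = β₁(y₀) β₂(x)`, `x = (y₁, y₂, y₃)`. [folklore] -/
def bump (y : 𝔼 4) : ℝ := β₁ (y 0) * β₂ (fibrePart y)

/-- **The pushed fold model** `F_θ(y) = F₀(y) + β(y) θ`. [cite: BaykurSaeki2017, §3] -/
def foldPushMap (θ : 𝔼 2) (y : 𝔼 4) : 𝔼 2 := foldSigMap s₁ s₂ s₃ y + bump β₁ β₂ y • θ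

/-- The plane map `T_θ(a, b) = (a + θ₀ β₁(a), b + θ₁ β₁(a))`, written on `ℝ²`:
`T_θ w = w + β₁(w₀) θ`. [folklore] -/
def pushPlaneMap (θ : 𝔼 2) (w : 𝔼 2) : 𝔼 2 := w + β₁ (w 0) • θ

/-! ### The differential near the axis -/

/-- The model differential near the axis: `v ↦ (c v₀, 2s₁y₁v₁ + 2s₂y₂v₂ + 2s₃y₃v₃ + d v₀)`.
[folklore] -/
def axisDeriv (c d : ℝ) (y : 𝔼 4) : 𝔼 4 →L[ℝ] 𝔼 2 :=
  (c • π₄ 0).smulRight (EuclideanSpace.single (0 : Fin 2) (1 : ℝ)) +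
    ((2 * s₁ * y 1) • π₄ 1 + (2 * s₂ * y 2) • π₄ 2 + (2 * s₃ * y 3) • π₄ 3 + d • π₄ 0).smulRight
      (EuclideanSpace.single (1 : Fin 2) (1 : ℝ))

/-- Component `0` of `axisDeriv`. [folklore] -/
@[simp] theorem axisDeriv_apply_zero (c d : ℝ) (y v : 𝔼 4) :
    axisDeriv s₁ s₂ s₃ c d y v 0 = c * v 0 := by
  simp [axisDeriv]

/-- Component `1` of `axisDeriv`. [folklore] -/
@[simp] theorem axisDeriv_apply_one (c d : ℝ) (y v : 𝔼 4) :
    axisDeriv s₁ s₂ s₃ c d y v 1 =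
      2 * s₁ * y 1 * v 1 + 2 * s₂ * y 2 * v 2 + 2 * s₃ * y 3 * v 3 + d * v 0 := by
  simp [axisDeriv]

/-- **Surjectivity of the model differential near the axis** (`c ≠ 0`, `sᵢ ≠ 0`): onto iff
`(y₁, y₂, y₃) ≠ 0`. [folklore] -/
theorem surjective_axisDeriv_iff {c : ℝ} (hc : c ≠ 0) (d : ℝ) (hs₁ : s₁ ≠ 0) (hs₂ : s₂ ≠ 0)
    (hs₃ : s₃ ≠ 0) (y : 𝔼 4) :
    Surjective (axisDeriv s₁ s₂ s₃ c d y) ↔ ¬ (y 1 = 0 ∧ y 2 = 0 ∧ y 3 = 0) := by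
  constructor
  · rintro hs ⟨h1, h2, h3⟩
    obtain ⟨v, hv⟩ := hs (EuclideanSpace.single (1 : Fin 2) (1 : ℝ))
    have h0 := congrArg (fun w : 𝔼 2 => w 0) hv
    have h1' := congrArg (fun w : 𝔼 2 => w 1) hv
    simp at h0 h1'
    rcases h0 with h0 | h0
    · exact hc h0
    · rw [h0, h1, h2, h3] at h1'
      simp at h1'
  · intro hx w
    set a : ℝ := w 0 / c with ha
    by_cases h1 : y 1 = 0
    · by_cases h2 : y 2 = 0
      · have h3 : y 3 ≠ 0 := fun h3 => hx ⟨h1, h2, h3⟩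
        refine ⟨a • EuclideanSpace.single (0 : Fin 4) (1 : ℝ) +
          ((w 1 - d * a) / (2 * s₃ * y 3)) • EuclideanSpace.single (3 : Fin 4) (1 : ℝ), ?_⟩
        ext i
        fin_cases i
        · simp [ha]
          field_simp
        · simp [h1, h2, ha]
          field_simp
          ring
      · refine ⟨a • EuclideanSpace.single (0 : Fin 4) (1 : ℝ) +
          ((w 1 - d * a) / (2 * s₂ * y 2)) • EuclideanSpace.single (2 : Fin 4) (1 : ℝ), ?_⟩
        ext i
        fin_cases i
        · simp [ha]
          field_simp
        · simp [h1, ha]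
          field_simp
          ring
    · refine ⟨a • EuclideanSpace.single (0 : Fin 4) (1 : ℝ) +
        ((w 1 - d * a) / (2 * s₁ * y 1)) • EuclideanSpace.single (1 : Fin 4) (1 : ℝ), ?_⟩
      ext i
      fin_cases i
      · simp [ha]
        field_simp
      · simp [ha]
        field_simp
        ring

variable {s₁ s₂ s₃ β₁ β₂}

/-- The bump is `C^∞`. [folklore] -/
theorem contDiff_bump : ContDiff ℝ ∞ (bump β₁ β₂) :=
  (β₁.contDiff.comp (π₄ 0).contDiff).mul (β₂.contDiff.comp fibrePart.contDiff)

/-- The pushed model is `C^∞`. [folklore] -/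
theorem contDiff_foldPushMap (θ : 𝔼 2) : ContDiff ℝ ∞ (foldPushMap s₁ s₂ s₃ β₁ β₂ θ) :=
  (contDiff_foldSigMap s₁ s₂ s₃).add (contDiff_bump.smul contDiff_const)

/-- The differential of the pushed model: `dF_θ(y) = dF₀(y) + dβ(y)(·) θ`. [folklore] -/
theorem hasFDerivAt_foldPushMap (θ : 𝔼 2) (y : 𝔼 4) :
    HasFDerivAt (foldPushMap s₁ s₂ s₃ β₁ β₂ θ)
      (foldSigDeriv s₁ s₂ s₃ y + (fderiv ℝ (bump β₁ β₂) y).smulRight θ) y :=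
  (hasFDerivAt_foldSigMap s₁ s₂ s₃ y).add
    ((contDiff_bump.differentiable (by simp) y).hasFDerivAt.smul_const θ)

/-- `fderiv` form. [folklore] -/
theorem fderiv_foldPushMap (θ : 𝔼 2) (y : 𝔼 4) :
    fderiv ℝ (foldPushMap s₁ s₂ s₃ β₁ β₂ θ) y =
      foldSigDeriv s₁ s₂ s₃ y + (fderiv ℝ (bump β₁ β₂) y).smulRight θ :=
  (hasFDerivAt_foldPushMap θ y).fderiv

/-! ### Off the support and near the axis -/

/-- Off the support of the bump, `F_θ = F₀` near `y`. [folklore] -/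
theorem foldPushMap_eventuallyEq_of_notMem {y : 𝔼 4} (hy : y ∉ tsupport (bump β₁ β₂)) (θ : 𝔼 2) :
    foldPushMap s₁ s₂ s₃ β₁ β₂ θ =ᶠ[𝓝 y] foldSigMap s₁ s₂ s₃ := by
  filter_upwards [(isClosed_tsupport _).isOpen_compl.mem_nhds hy] with z hz
  simp only [foldPushMap, image_eq_zero_of_notMem_tsupport hz, zero_smul, add_zero]

/-- Near the axis (`‖x‖ < rIn(β₂)`), the bump is `β₁(y₀)` near `y`. [folklore] -/
theorem bump_eventuallyEq_of_norm_lt {y : 𝔼 4} (hy : ‖fibrePart y‖ < β₂.rIn) :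
    bump β₁ β₂ =ᶠ[𝓝 y] fun z => β₁ (z 0) := by
  have h1 : (β₂ : 𝔼 3 → ℝ) =ᶠ[𝓝 (fibrePart y)] 1 :=
    β₂.eventuallyEq_one_of_mem_ball (by simpa using hy)
  have h2 := (fibrePart.continuous.continuousAt (x := y)).eventually h1
  filter_upwards [h2] with z hz
  simp only [bump, hz, Pi.one_apply, mul_one]

/-- **Near the axis `F_θ = T_θ ∘ F₀`.** [cite: BaykurSaeki2017, §3] -/
theorem foldPushMap_eventuallyEq_near_axis {y : 𝔼 4} (hy : ‖fibrePart y‖ < β₂.rIn) (θ : 𝔼 2) :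
    foldPushMap s₁ s₂ s₃ β₁ β₂ θ =ᶠ[𝓝 y] (pushPlaneMap β₁ θ ∘ foldSigMap s₁ s₂ s₃) := by
  filter_upwards [bump_eventuallyEq_of_norm_lt (β₁ := β₁) hy] with z hz
  simp only [foldPushMap, hz, Function.comp_apply, pushPlaneMap, foldSigMap_apply_zero]

/-! ### The differential near the axis, identified -/

/-- Near the axis, `dF_θ(y) = axisDeriv (1 + β₁'(y₀) θ₀) (β₁'(y₀) θ₁) y`. [folklore] -/
theorem fderiv_foldPushMap_of_norm_lt {y : 𝔼 4} (hy : ‖fibrePart y‖ < β₂.rIn) (θ : 𝔼 2) :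
    fderiv ℝ (foldPushMap s₁ s₂ s₃ β₁ β₂ θ) y =
      axisDeriv s₁ s₂ s₃ (1 + deriv β₁ (y 0) * θ 0) (deriv β₁ (y 0) * θ 1) y := by
  have hev : foldPushMap s₁ s₂ s₃ β₁ β₂ θ =ᶠ[𝓝 y] fun z => foldSigMap s₁ s₂ s₃ z + β₁ (z 0) • θ := by
    filter_upwards [bump_eventuallyEq_of_norm_lt (β₁ := β₁) hy] with z hz
    simp only [foldPushMap, hz]
  rw [hev.fderiv_eq]
  have hb : HasFDerivAt (fun z : 𝔼 4 => β₁ (z 0))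
      ((ContinuousLinearMap.smulRight (1 : ℝ →L[ℝ] ℝ) (deriv β₁ (y 0))).comp (π₄ 0)) y :=
    ((β₁.contDiff (n := ⊤)).differentiable (by simp) _).hasDerivAt.hasFDerivAt.comp y
      (π₄ 0).hasFDerivAt
  have hd : HasFDerivAt (fun z => foldSigMap s₁ s₂ s₃ z + β₁ (z 0) • θ)
      (foldSigDeriv s₁ s₂ s₃ y +
        ((ContinuousLinearMap.smulRight (1 : ℝ →L[ℝ] ℝ) (deriv β₁ (y 0))).comp (π₄ 0)).smulRight θ)
      y := (hasFDerivAt_foldSigMap s₁ s₂ s₃ y).add (hb.smul_const θ)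
  rw [hd.fderiv]
  ext v i
  fin_cases i
  · simp
    ring
  · simp
    ring

/-! ### The critical set of the pushed model is the axis -/

/-- The compact part of the support of the bump away from the axis. [folklore] -/
def shell (β₁ : ContDiffBump (0 : ℝ)) (β₂ : ContDiffBump (0 : 𝔼 3)) : Set (𝔼 4) :=
  unfibre '' (closedBall (0 : ℝ) β₁.rOut ×ˢ (closedBall (0 : 𝔼 3) β₂.rOut ∩ {x | β₂.rIn ≤ ‖x‖}))

/-- The shell is compact. [folklore] -/
theorem isCompact_shell (β₁ : ContDiffBump (0 : ℝ)) (β₂ : ContDiffBump (0 : 𝔼 3)) :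
    IsCompact (shell β₁ β₂) :=
  ((isCompact_closedBall _ _).prod ((isCompact_closedBall _ _).inter_right
    (isClosed_le continuous_const continuous_norm))).image unfibre.continuous

/-- Membership in the shell. [folklore] -/
theorem mem_shell {β₁ : ContDiffBump (0 : ℝ)} {β₂ : ContDiffBump (0 : 𝔼 3)} {y : 𝔼 4}
    (h0 : |y 0| ≤ β₁.rOut) (h1 : ‖fibrePart y‖ ≤ β₂.rOut) (h2 : β₂.rIn ≤ ‖fibrePart y‖) :
    y ∈ shell β₁ β₂ :=
  ⟨(y 0, fibrePart y), ⟨by simpa using h0, by simpa using h1, h2⟩, unfibre_fibrePart y⟩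

/-- On the support of the bump, `|y₀| ≤ rOut(β₁)` and `‖x‖ ≤ rOut(β₂)`. [folklore] -/
theorem bounds_of_mem_tsupport {y : 𝔼 4} (hy : y ∈ tsupport (bump β₁ β₂)) :
    |y 0| ≤ β₁.rOut ∧ ‖fibrePart y‖ ≤ β₂.rOut := by
  have h1 : tsupport (bump β₁ β₂) ⊆ {z : 𝔼 4 | |z 0| ≤ β₁.rOut} := by
    refine (tsupport_mul_subset_left).trans (closure_minimal ?_ ?_)
    · intro z hz
      by_contra h
      simp only [mem_setOf_eq, not_le] at h
      apply hz
      show β₁ (z 0) = 0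
      exact β₁.zero_of_le_dist (by simpa [Real.dist_eq] using h.le)
    · exact isClosed_le (continuous_abs.comp (π₄ 0).continuous) continuous_const
  have h2 : tsupport (bump β₁ β₂) ⊆ {z : 𝔼 4 | ‖fibrePart z‖ ≤ β₂.rOut} := by
    refine (tsupport_mul_subset_right).trans (closure_minimal ?_ ?_)
    · intro z hz
      by_contra h
      simp only [mem_setOf_eq, not_le] at h
      apply hz
      show β₂ (fibrePart z) = 0
      exact β₂.zero_of_le_dist (by simpa using h.le)
    · exact isClosed_le (continuous_norm.comp fibrePart.continuous) continuous_const
  exact ⟨h1 hy, h2 hy⟩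

/-- The joint differential `(θ, y) ↦ dF_θ(y)` is continuous. [folklore] -/
theorem continuous_jointDeriv :
    Continuous fun p : 𝔼 2 × 𝔼 4 =>
      foldSigDeriv s₁ s₂ s₃ p.2 + (fderiv ℝ (bump β₁ β₂) p.2).smulRight p.1 := by
  have h1 : Continuous fun y : 𝔼 4 => foldSigDeriv s₁ s₂ s₃ y := by
    have h := (contDiff_foldSigMap s₁ s₂ s₃).continuous_fderiv (by simp)
    have heq : fderiv ℝ (foldSigMap s₁ s₂ s₃) = fun y => foldSigDeriv s₁ s₂ s₃ y :=
      funext (fderiv_foldSigMap s₁ s₂ s₃)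
    rw [heq] at h
    exact h
  have h2 : Continuous fun y : 𝔼 4 => fderiv ℝ (bump β₁ β₂) y :=
    contDiff_bump.continuous_fderiv (by simp)
  have h3 : Continuous fun p : 𝔼 2 × 𝔼 4 => (fderiv ℝ (bump β₁ β₂) p.2).smulRight p.1 :=
    ((ContinuousLinearMap.smulRightL ℝ (𝔼 4) (𝔼 2)).continuous₂.comp
      ((h2.comp continuous_snd).prodMk continuous_fst)).congr fun p => by
        simp [Function.comp, Function.uncurry]
  exact (h1.comp continuous_snd).add h3

/-- **The critical set of the pushed fold is the axis, for small pushes.**  For `sᵢ ≠ 0` there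
is `ε > 0` such that for every `θ` with `‖θ‖ < ε` the differential of
`F_θ = F₀ + β₁(t)β₂(x) θ` at `y` is onto iff `(y₁, y₂, y₃) ≠ 0`.
[cite: BaykurSaeki2017, §3] [cite: GolubitskyGuillemin1973, Ch. III §4] -/
theorem exists_surjective_fderiv_foldPushMap_iff (hs₁ : s₁ ≠ 0) (hs₂ : s₂ ≠ 0) (hs₃ : s₃ ≠ 0)
    (β₁ : ContDiffBump (0 : ℝ)) (β₂ : ContDiffBump (0 : 𝔼 3)) :
    ∃ ε > 0, ∀ θ : 𝔼 2, ‖θ‖ < ε → ∀ y : 𝔼 4,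
      (Surjective (fderiv ℝ (foldPushMap s₁ s₂ s₃ β₁ β₂ θ) y) ↔ ¬ (y 1 = 0 ∧ y 2 = 0 ∧ y 3 = 0)) := by
  -- Region B: tube lemma around `{0} × shell`
  set D : 𝔼 2 × 𝔼 4 → 𝔼 4 →L[ℝ] 𝔼 2 := fun p =>
    foldSigDeriv s₁ s₂ s₃ p.2 + (fderiv ℝ (bump β₁ β₂) p.2).smulRight p.1 with hD
  have hDc : Continuous D := continuous_jointDeriv
  have hO : IsOpen {p : 𝔼 2 × 𝔼 4 | Surjective (D p)} := by
    have h := isOpen_inter_setOf_surjective (T := D) isOpen_univ hDc.continuousOn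
    simpa using h
  have hsz : ∀ c : 𝔼 4 →L[ℝ] ℝ, c.smulRight (0 : 𝔼 2) = 0 := fun c => by ext v; simp
  have hsub : ({(0 : 𝔼 2)} : Set (𝔼 2)) ×ˢ shell β₁ β₂ ⊆ {p | Surjective (D p)} := by
    rintro ⟨θ, y⟩ ⟨hθ, hy⟩
    rw [mem_singleton_iff] at hθ
    subst hθ
    obtain ⟨⟨a, x⟩, ⟨-, -, hx⟩, rfl⟩ := hy
    show Surjective (foldSigDeriv s₁ s₂ s₃ (unfibre (a, x)) +
      (fderiv ℝ (bump β₁ β₂) (unfibre (a, x))).smulRight (0 : 𝔼 2))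
    rw [hsz, add_zero, surjective_foldSigDeriv_iff hs₁ hs₂ hs₃]
    rintro ⟨h1, h2, h3⟩
    have hx0 : x = 0 := by
      ext i
      fin_cases i
      · simpa using (unfibre_apply_succ (a, x) 0).symm.trans h1
      · simpa using (unfibre_apply_succ (a, x) 1).symm.trans h2
      · simpa using (unfibre_apply_succ (a, x) 2).symm.trans h3
    have hx' : β₂.rIn ≤ ‖x‖ := hx
    rw [hx0, norm_zero] at hx'
    exact not_lt.2 hx' β₂.rIn_pos
  obtain ⟨U, V, hUo, -, h0U, hKV, hUV⟩ :=
    generalized_tube_lemma isCompact_singleton (isCompact_shell β₁ β₂) hO hsub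
  obtain ⟨ε₁, hε₁, hball⟩ := Metric.isOpen_iff.1 hUo 0 (h0U rfl)
  -- Region A: a bound on `β₁'`
  obtain ⟨C, hC⟩ := (β₁.contDiff (n := ⊤)).continuous_deriv (by simp)
    |>.bounded_above_of_compact_support β₁.hasCompactSupport.deriv
  set ε₂ : ℝ := 1 / (2 * |C| + 2) with hε₂
  have hε₂pos : 0 < ε₂ := by positivity
  refine ⟨min ε₁ ε₂, lt_min hε₁ hε₂pos, fun θ hθ y => ?_⟩
  have hθ₁ : ‖θ‖ < ε₁ := lt_of_lt_of_le hθ (min_le_left _ _)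
  have hθ₂ : ‖θ‖ < ε₂ := lt_of_lt_of_le hθ (min_le_right _ _)
  by_cases hA : ‖fibrePart y‖ < β₂.rIn
  · -- near the axis: explicit differential
    have hc : 1 + deriv β₁ (y 0) * θ 0 ≠ 0 := by
      have h1 : |deriv β₁ (y 0)| ≤ |C| := (hC (y 0)).trans (le_abs_self C)
      have h2 : |θ 0| ≤ ‖θ‖ := by simpa using PiLp.norm_apply_le θ 0
      have h3 : |deriv β₁ (y 0) * θ 0| < 1 / 2 := by
        rw [abs_mul]
        calc |deriv β₁ (y 0)| * |θ 0| ≤ |C| * ‖θ‖ := by gcongr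
          _ ≤ |C| * ε₂ := by gcongr
          _ < 1 / 2 := by
            rw [hε₂, ← mul_div_assoc, mul_one, div_lt_div_iff₀ (by positivity) (by positivity)]
            linarith [abs_nonneg C]
      intro h0
      have : deriv β₁ (y 0) * θ 0 = -1 := by linarith
      rw [this, abs_neg, abs_one] at h3
      norm_num at h3
    rw [fderiv_foldPushMap_of_norm_lt hA, surjective_axisDeriv_iff s₁ s₂ s₃ hc _ hs₁ hs₂ hs₃]
  · by_cases hB : y ∈ tsupport (bump β₁ β₂)
    · -- on the shell: submersive by the tube lemma
      obtain ⟨h0, h1⟩ := bounds_of_mem_tsupport hB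
      have hyK : y ∈ shell β₁ β₂ := mem_shell h0 h1 (not_lt.1 hA)
      have hmem : (θ, y) ∈ U ×ˢ V := ⟨hball (by simpa using hθ₁), hKV hyK⟩
      have hsurj : Surjective (D (θ, y)) := hUV hmem
      rw [fderiv_foldPushMap]
      refine ⟨fun _ => ?_, fun _ => hsurj⟩
      rintro ⟨h1', h2', h3'⟩
      have hx0 : fibrePart y = 0 := by
        ext i
        fin_cases i
        · simpa [fibrePart_apply] using h1'
        · simpa [fibrePart_apply] using h2'
        · simpa [fibrePart_apply] using h3'
      rw [hx0, norm_zero] at hA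
      exact hA β₂.rIn_pos
    · -- off the support: `F_θ = F₀` near `y`
      rw [(foldPushMap_eventuallyEq_of_notMem hB θ).fderiv_eq,
        surjective_fderiv_foldSigMap_iff hs₁ hs₂ hs₃]

end FoldPush

end Literature.Topology.FourManifolds
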